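import Summits.BirchSwinnertonDyer.BirchSwinnertonDyer.Theorems.SchneiderFreeAdditiveX3BranchIMCRebaseGenus
import Literature.NumberTheory.EllipticCurves.Gross2004.RationalCharacterLSeries
import Literature.NumberTheory.EllipticCurves.HeegnerHypothesisKroneckerProofs
import Literature.NumberTheory.QuadraticFields.FundamentalDiscriminant
import HarnessLib

/-!
# Route `SchneiderFreeAdditiveX3` (K1 door), crux `GordTwoBranchIMC` (stmt-BirchSwinnertonDyer-19177):
# link (L1) of the rebased road — the ARTIN LINK `L′(f_{W′}, χ_ε, 1) = L′(E/K, 1)` — discharged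
# from Gross's genus factorisation (published, named fact) and modularity

Cell `bsd-schneider-ideate`, seat `bsd-schneider-door-c3` (prover, generation 6). HONEST FRAMING:
the rebased road of generations 3–5 (`…BranchIMCRebaseGenus.lean`,
`additiveIMCLowerBDPOnTreeLeAt_of_valueAt_twisted_of_genusDatum'`, and the non-torsion lemma
`not_isOfFinAddOrder_charHeegnerPoint_of_artin`) carries the hypothesis
(L1) `rankinSelbergDerivValue Dt′.f χ_gal 1 = LDerivEK W K`: the derivative at `s = 1` of the
Rankin–Selberg `L`-function of the good-ordinary partner `W′` twisted by the genus character
`χ = ε_K` of conductor `p` equals `L′(E/K, 1) = (L(W, s) L(W^{(d_K)}, s))′(1)` for the door's curve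
`W = C₂ • ((D • W′) ⊗ χ_{p*})`. This file PROVES (L1) from two PUBLISHED named facts of the tree and
nothing else:

* `Gross2004.rankinLSeries_eq_mul_quadraticTwist` (B. H. Gross, MSRI Publ. 49 (2004), §2 p. 40:
  for a RATIONAL ring class character attached to a factorisation `d_K c² = d₁ d₂` into fundamental
  discriminants, `L(f, χ, s) = L(A₁, s) L(A₂, s)` with `A_i = E^{(d_i)}`), read at `c = p`,
  `d₁ = p* = (−1)^{(p−1)/2} p`, `d₂ = d_K p*` — the genus datum `θ ∈ K[p]`, `θ² = p*`,
  `σθ = χ(σ)θ` that the road already carries says exactly that `χ_gal` is the rational character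
  of `d₁ = p*` (`isRationalCharacterFor_of_genusDatum`);
* `hasEntireLFunction_rat` (modularity: entire continuation of `L(E^{(d)}, s)`), through the tree's
  proved corollary `rankinLSeries_eq_mul_quadraticTwist.rankinSelbergDerivValue_eq_deriv_mul`;

and the model bookkeeping `W ≅ W′ ⊗ p*`, `W ⊗ d_K ≅ W′ ⊗ (p* d_K)` (tree: `quadraticTwist_smul`,
`quadraticTwist_quadraticTwist`, `entireLFunction_smul`). The arithmetic side conditions — `p*`
and `d_K p*` are fundamental discriminants when `p ∤ d_K` — are proved here (§2) from the tree's
`Quadratic.isFundamentalDiscriminant_discr`.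

So the rebased road's external inputs at a frame now read: Keller–Yin's divisibility (PREPRINT —
the crux), the conductor-`p` VALUE FORMULA at the descended point (Castella–Hsieh Thm. 5.7 +
Lemma 5.4, print, untyped), the genus datum `θ` (class field theory), the Heegner condition for
`(W′, χ)`, and the published facts Gross 2004 / modularity / Gross–Zagier / Kolyvagin /
Cai–Shu–Tian — the road and the non-torsion lemma with (L1) replaced by these facts are the sibling
file `…BranchIMCRebaseArtinRoad.lean`. NOTHING is asserted about BSD; the crux stays OPEN;
`--supports` material for item 19177.

References: B. H. Gross, *Heegner points and representation theory*, MSRI Publ. 49 (2004) §2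
p. 40; Gross–Zagier 1986 I.(6.3); Cai–Shu–Tian 2014 Thm. 1.1; Silverman AEC X.2, C.16; Cohen,
*A Course in Computational Algebraic Number Theory*, Def. 5.1.2 (fundamental discriminants).
-/

noncomputable section

open scoped Classical ComplexConjugate

open WeierstrassCurve NumberField IsDedekindDomain Field
  Literature.NumberTheory.EllipticCurves
  Literature.NumberTheory.EllipticCurves.CaiShuTian2014
  Literature.NumberTheory.EllipticCurves.ModularForms
  Literature.NumberTheory.EllipticCurves.GreenbergSelmer
  Literature.NumberTheory.EllipticCurves.Rank1Residual
  Literature.NumberTheory.GaloisRepresentations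
  Summit.BirchSwinnertonDyer.Rank1Residual
  Summit.BirchSwinnertonDyer.Rank1Residual.X11b
  Summit.BirchSwinnertonDyer.Rank1Residual.X11b.AcSelmer
  Summit.BirchSwinnertonDyer.Rank1Residual.X11b.Halves

-- D-0017 layout: summit = sub-problem, so `Summit.BirchSwinnertonDyer.BirchSwinnertonDyer.…` is the
-- mandated namespace (same option as the route's sockets files).
set_option linter.dupNamespace false
set_option autoImplicit false

namespace Summit.BirchSwinnertonDyer.BirchSwinnertonDyer.Theorems.SchneiderFree

/-! ## §1 The genus datum says: `χ_gal` is the rational character of `d = θ²` -/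

/-- **The genus datum makes `χ_gal` a rational character (Gross's dictionary).** If the ring class
character `χ = s` of `Gal(K[c]/K)` is `{±1}`-valued and `K[c]` contains `θ ≠ 0` with `θ² = d`
(`d ∈ ℤ`) on which `Gal(K[c]/K)` acts through `χ` (`σθ = χ(σ)θ`), then the Galois character
`χ_gal` inflated from `χ` along `emb : K[c] → K̄` (`IsInflationAlong`) is the rational character of
`d` in the sense of `Gross2004.IsRationalCharacterFor`: with `r = emb θ`, `r² = d` and
`χ_gal(γ) = +1` iff `γ` fixes `r`. (Pure bookkeeping: `γ·r = emb(σ_γ θ) = χ(σ_γ) r` and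
`−r ≠ r` in characteristic `0`.) [cite: Gross2004, §2 p. 40 (rational characters ↔ factorizations D = d₁d₂; dictionary)] -/
theorem isRationalCharacterFor_of_genusDatum
    {K : Type} [Field K] [NumberField K] (ιc : K →+* ℂ) (c : ℕ)
    (χ : ringClassGal ιc c →* ℂˣ) (χgal : Field.absoluteGaloisGroup K →ₜ* ℂˣ)
    (emb : ringClassField K ιc c →+* AlgebraicClosure K)
    (hinfl : IsInflationAlong ιc c emb χ χgal)
    (s : ringClassGal ιc c → ℤˣ) (hχ : ∀ σ, ((χ σ : ℂˣ) : ℂ) = ((s σ : ℤ) : ℂ))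
    {d : ℤ} (θ : ringClassField K ιc c) (hθ2 : θ ^ 2 = (d : ringClassField K ιc c)) (hθ : θ ≠ 0)
    (hθσ : ∀ σ : ringClassGal ιc c, σ.1 θ = ((s σ : ℤ) : ringClassField K ιc c) * θ) :
    Gross2004.IsRationalCharacterFor χgal d := by
  refine ⟨emb θ, by rw [← map_pow, hθ2, map_intCast], fun γ ↦ ?_⟩
  obtain ⟨σ, hσ⟩ := hinfl.1 γ
  have hγ : γ • emb θ = ((s σ : ℤ) : AlgebraicClosure K) * emb θ := by
    rw [← hσ θ, hθσ σ, map_mul, map_intCast]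
  have hval : ((χgal γ : ℂˣ) : ℂ) = ((s σ : ℤ) : ℂ) := by rw [hinfl.2 γ σ hσ, hχ σ]
  have hr0 : emb θ ≠ 0 := (map_ne_zero_iff emb emb.injective).mpr hθ
  rcases Int.units_eq_one_or (s σ) with h1 | h1
  · have hfix : γ • emb θ = emb θ := by rw [hγ, h1]; simp
    rw [hval, h1, if_pos hfix]
    simp
  · have hne : γ • emb θ ≠ emb θ := by
      rw [hγ, h1]
      intro h
      apply hr0
      have h2 : (2 : AlgebraicClosure K) * emb θ = 0 := by
        push_cast at h
        linear_combination -h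
      simpa using h2
    rw [hval, h1, if_neg hne]
    simp

/-! ## §2 Fundamental discriminants: `p*` and `d · p*` -/

/-- `p* = (−1)^{(p−1)/2} p ≡ 1 (mod 4)` for an odd prime `p`. [folklore] -/
theorem pStar_emod_four {p : ℕ} (hp : p.Prime) (hp2 : p ≠ 2) :
    ((-1 : ℤ) ^ (p / 2) * p) % 4 = 1 := by
  obtain ⟨k, hk⟩ := hp.eq_two_or_odd'.resolve_left hp2
  subst hk
  have hdiv : (2 * k + 1) / 2 = k := by omega
  rw [hdiv]
  rcases Nat.even_or_odd k with ⟨m, rfl⟩ | ⟨m, rfl⟩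
  · rw [← two_mul, pow_mul, neg_one_sq, one_pow, one_mul]
    push_cast
    omega
  · rw [pow_succ, pow_mul, neg_one_sq, one_pow, one_mul]
    push_cast
    omega

/-- `(p*)² = p²`. [folklore] -/
theorem pStar_sq (p : ℕ) : ((-1 : ℤ) ^ (p / 2) * p) ^ 2 = (p : ℤ) ^ 2 := by
  rw [mul_pow, ← pow_mul, mul_comm (p / 2) 2, pow_mul, neg_one_sq, one_pow, one_mul]

/-- `p*` is `± p`, hence prime in `ℤ`. [folklore] -/
theorem prime_pStar {p : ℕ} (hp : p.Prime) : Prime ((-1 : ℤ) ^ (p / 2) * p) := by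
  have hpZ : Prime (p : ℤ) := Nat.prime_iff_prime_int.mp hp
  rcases neg_one_pow_eq_or ℤ (p / 2) with h | h
  · rw [h, one_mul]; exact hpZ
  · rw [h, neg_one_mul]; exact hpZ.neg

/-- **`p*` is a fundamental discriminant** (`≡ 1 (mod 4)`, squarefree, `≠ 1`), in the spelling of
`Gross2004.rankinLSeries_eq_mul_quadraticTwist`. [folklore] -/
theorem isFundamental_pStar {p : ℕ} (hp : p.Prime) (hp2 : p ≠ 2) :
    (((-1 : ℤ) ^ (p / 2) * p) % 4 = 1 ∧ Squarefree ((-1 : ℤ) ^ (p / 2) * p) ∧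
        ((-1 : ℤ) ^ (p / 2) * p) ≠ 1) ∨
      (4 ∣ ((-1 : ℤ) ^ (p / 2) * p) ∧
        (((-1 : ℤ) ^ (p / 2) * p) / 4 % 4 = 2 ∨ ((-1 : ℤ) ^ (p / 2) * p) / 4 % 4 = 3) ∧
        Squarefree (((-1 : ℤ) ^ (p / 2) * p) / 4)) := by
  refine Or.inl ⟨pStar_emod_four hp hp2, (prime_pStar hp).squarefree, fun h ↦ ?_⟩
  have hq : Prime ((-1 : ℤ) ^ (p / 2) * p) := prime_pStar hp
  rw [h] at hq
  exact hq.not_unit isUnit_one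

/-- **`d · p*` is a fundamental discriminant** whenever `d` is one and the odd prime `p` does not
divide `d` (the two cases `d ≡ 1 (mod 4)` squarefree and `d = 4m`, `m ≡ 2, 3 (mod 4)` squarefree
are preserved because `p* ≡ 1 (mod 4)` is squarefree and prime to `d`). [folklore] -/
theorem isFundamental_mul_pStar {p : ℕ} (hp : p.Prime) (hp2 : p ≠ 2) {d : ℤ}
    (hd : (d % 4 = 1 ∧ Squarefree d ∧ d ≠ 1) ∨
      (4 ∣ d ∧ (d / 4 % 4 = 2 ∨ d / 4 % 4 = 3) ∧ Squarefree (d / 4)))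
    (hpd : ¬ (p : ℤ) ∣ d) :
    ((d * ((-1 : ℤ) ^ (p / 2) * p)) % 4 = 1 ∧ Squarefree (d * ((-1 : ℤ) ^ (p / 2) * p)) ∧
        d * ((-1 : ℤ) ^ (p / 2) * p) ≠ 1) ∨
      (4 ∣ d * ((-1 : ℤ) ^ (p / 2) * p) ∧
        ((d * ((-1 : ℤ) ^ (p / 2) * p)) / 4 % 4 = 2 ∨
          (d * ((-1 : ℤ) ^ (p / 2) * p)) / 4 % 4 = 3) ∧
        Squarefree ((d * ((-1 : ℤ) ^ (p / 2) * p)) / 4)) := by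
  set q : ℤ := (-1 : ℤ) ^ (p / 2) * p with hq
  have hq4 : q % 4 = 1 := pStar_emod_four hp hp2
  have hqprime : Prime q := prime_pStar hp
  have hpq : (p : ℤ) ∣ q := Dvd.intro_left _ rfl
  -- `q` is prime to every integer that `p` does not divide
  have hrel : ∀ {e : ℤ}, ¬ (p : ℤ) ∣ e → IsRelPrime e q := fun {e} he ↦
    (hqprime.irreducible.isRelPrime_iff_not_dvd.mpr fun h ↦ he (hpq.trans h)).symm
  rcases hd with ⟨hd4, hsq, hd1⟩ | ⟨h4, hm, hsq⟩
  · refine Or.inl ⟨?_, squarefree_mul_iff.mpr ⟨hrel hpd, hsq, hqprime.squarefree⟩, fun h ↦ ?_⟩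
    · rw [Int.mul_emod, hd4, hq4]; decide
    · exact hp.not_dvd_one (by exact_mod_cast (show (p : ℤ) ∣ 1 from h ▸ hpq.mul_left d))
  · obtain ⟨m, rfl⟩ := h4
    have hpm : ¬ (p : ℤ) ∣ m := fun h ↦ hpd (h.mul_left 4)
    have hdiv : 4 * m * q / 4 = m * q := by
      rw [mul_assoc, Int.mul_ediv_cancel_left _ (by norm_num)]
    have hdiv' : 4 * m / 4 = m := Int.mul_ediv_cancel_left _ (by norm_num)
    rw [hdiv'] at hm hsq
    refine Or.inr ⟨Dvd.intro (m * q) (by ring), ?_, ?_⟩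
    · rw [hdiv, Int.mul_emod, hq4]
      rcases hm with hm | hm <;> rw [hm] <;> decide
    · rw [hdiv]
      exact squarefree_mul_iff.mpr ⟨hrel hpm, hsq, hqprime.squarefree⟩

/-- **`d_K · p*` is a fundamental discriminant** for a quadratic field `K` and an odd prime
`p ∤ d_K` (e.g. `p` split in `K`): `d_K` is fundamental (tree
`Quadratic.isFundamentalDiscriminant_discr`) and `isFundamental_mul_pStar`. [folklore] -/
theorem isFundamental_discr_mul_pStar {K : Type} [Field K] [NumberField K]
    (h2 : Module.finrank ℚ K = 2) {p : ℕ} (hp : p.Prime) (hp2 : p ≠ 2)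
    (hpd : ¬ (p : ℤ) ∣ NumberField.discr K) :
    ((NumberField.discr K * ((-1 : ℤ) ^ (p / 2) * p)) % 4 = 1 ∧
        Squarefree (NumberField.discr K * ((-1 : ℤ) ^ (p / 2) * p)) ∧
        NumberField.discr K * ((-1 : ℤ) ^ (p / 2) * p) ≠ 1) ∨
      (4 ∣ NumberField.discr K * ((-1 : ℤ) ^ (p / 2) * p) ∧
        ((NumberField.discr K * ((-1 : ℤ) ^ (p / 2) * p)) / 4 % 4 = 2 ∨
          (NumberField.discr K * ((-1 : ℤ) ^ (p / 2) * p)) / 4 % 4 = 3) ∧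
        Squarefree ((NumberField.discr K * ((-1 : ℤ) ^ (p / 2) * p)) / 4)) :=
  isFundamental_mul_pStar hp hp2
    (Literature.NumberTheory.QuadraticFields.Quadratic.isFundamentalDiscriminant_discr h2) hpd

/-! ## §3 The Artin link (L1) from Gross 2004 + modularity -/

/-- **(L1) — the Artin link of the rebased road, PROVED modulo Gross 2004 and modularity.** For
the door's curve `W = C₂ • ((D • W′) ⊗ χ_{p*})` presented through its good partner `W′`, an
imaginary quadratic `K` with `p ∤ d_K`, the genus character `χ = s` of `Gal(K[p]/K)` with its
Galois character `χ_gal` (inflation along `emb`), primitive of conductor `p`, satisfying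
Cai–Shu–Tian's Heegner condition for `(W′, p, χ)`, and the genus datum `θ ∈ K[p]`, `θ² = p*`,
`σθ = χ(σ)θ`:
`L′(f_{W′}, χ, 1) = L′(E/K, 1)`, i.e. `rankinSelbergDerivValue Dt′.f χ_gal 1 = LDerivEK W K`.
Proof: Gross's factorisation at `(d₁, d₂) = (p*, d_K p*)` (`d₁ d₂ = d_K p²`, both fundamental by
§2, `χ_gal` rational for `p*` by §1) gives `L′(f_{W′}, χ, 1) = (L(W′^{(p*)}, ·) L(W′^{(d_K p*)}, ·))′(1)`
(tree corollary `rankinSelbergDerivValue_eq_deriv_mul`, using modularity), and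
`L(W, s) = L(W′^{(p*)}, s)`, `L(W^{(d_K)}, s) = L(W′^{(p* d_K)}, s)` because the entire
`L`-function is an isomorphism invariant and twisting is multiplicative in the tree's model.
CONDITIONAL on the two cited named facts; nothing asserted about BSD.
[cite: Gross2004, §2 p. 40 ("L(f, χ, s) = L(A₁, s)L(A₂, s)")] -/
theorem artinLink_of_gross2004
    (hG : Gross2004.rankinLSeries_eq_mul_quadraticTwist) (hmod : hasEntireLFunction_rat)
    {p : ℕ} [Fact p.Prime] (hp2 : p ≠ 2)
    (W' : WeierstrassCurve ℚ) [W'.IsElliptic] [NeZero (W'.conductorNorm ℤ)]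
    (D C₂ : VariableChange ℚ)
    (K : Type) [Field K] [NumberField K] (hK : IsImaginaryQuadratic K)
    (hpd : ¬ (p : ℤ) ∣ NumberField.discr K)
    (ιc : K →+* ℂ) (Dt' : ModularParametrizationData W' (W'.conductorNorm ℤ))
    (χ : ringClassGal ιc p →* ℂˣ) (χgal : Field.absoluteGaloisGroup K →ₜ* ℂˣ)
    (emb : ringClassField K ιc p →+* AlgebraicClosure K)
    (hemb : ∀ k : K, emb (algebraMap K (ringClassField K ιc p) k) =
      algebraMap K (AlgebraicClosure K) k)
    (hinfl : IsInflationAlong ιc p emb χ χgal) (hprim : IsPrimitiveOfConductor ιc p χ)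
    (hHC : HeegnerConditionRC W' K p Dt'.f χgal)
    (s : ringClassGal ιc p → ℤˣ) (hχ : ∀ σ, ((χ σ : ℂˣ) : ℂ) = ((s σ : ℤ) : ℂ))
    (θ : ringClassField K ιc p)
    (hθ2 : θ ^ 2 = algebraMap ℚ (ringClassField K ιc p) ((-1 : ℚ) ^ (p / 2) * p)) (hθ : θ ≠ 0)
    (hθσ : ∀ σ : ringClassGal ιc p, σ.1 θ = ((s σ : ℤ) : ringClassField K ιc p) * θ) :
    rankinSelbergDerivValue Dt'.f χgal 1 =
      LDerivEK (C₂ • (D • W').quadraticTwist ((-1 : ℚ) ^ (p / 2) * p)) K := by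
  have hp : p.Prime := Fact.out
  set d₁ : ℤ := (-1 : ℤ) ^ (p / 2) * p with hd₁def
  set d₂ : ℤ := NumberField.discr K * d₁ with hd₂def
  have hcast : ((d₁ : ℤ) : ℚ) = (-1 : ℚ) ^ (p / 2) * p := by push_cast [hd₁def]; ring
  have hd₁0 : (d₁ : ℚ) ≠ 0 := by
    rw [hcast]; exact mul_ne_zero (pow_ne_zero _ (by norm_num)) (by exact_mod_cast hp.ne_zero)
  -- the genus datum ⇒ `χ_gal` is the rational character of `d₁ = p*`
  have hθ2' : θ ^ 2 = (d₁ : ringClassField K ιc p) := by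
    rw [hθ2, eq_ratCast, ← hcast, Rat.cast_intCast]
  have hrat : Gross2004.IsRationalCharacterFor χgal d₁ :=
    isRationalCharacterFor_of_genusDatum ιc p χ χgal emb hinfl s hχ θ hθ2' hθ hθσ
  -- the factorisation data `d_K p² = d₁ d₂`
  have hd₁ := isFundamental_pStar hp hp2
  have hd₂ := isFundamental_discr_mul_pStar hK.1 hp hp2 hpd
  have hD : d₁ * d₂ = NumberField.discr K * ((p : ℕ) : ℤ) ^ 2 := by
    rw [hd₂def, mul_left_comm, ← sq, hd₁def, pStar_sq]
  -- Gross 2004 + modularity: `L′(f_{W′}, χ, 1) = (L(W′^{(d₁)}) · L(W′^{(d₂)}))′(1)`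
  rw [hG.rankinSelbergDerivValue_eq_deriv_mul hmod W' K hK ιc p hp.ne_zero Dt' χ χgal emb hemb
    hinfl hprim hHC d₁ d₂ hd₁ hd₂ hD hrat 1]
  -- model bookkeeping: `L(W) = L(W′^{(d₁)})`, `L(W^{(d_K)}) = L(W′^{(d₂)})`
  haveI := W'.isElliptic_quadraticTwist hd₁0
  have hd₂0 : ((d₂ : ℤ) : ℚ) ≠ 0 := by
    have : d₂ ≠ 0 := mul_ne_zero (NumberField.discr_ne_zero K) (by exact_mod_cast hd₁0)
    exact_mod_cast this
  haveI := W'.isElliptic_quadraticTwist hd₂0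
  have e1 : (C₂ • (D • W').quadraticTwist ((-1 : ℚ) ^ (p / 2) * p)).entireLFunction =
      (W'.quadraticTwist (d₁ : ℚ)).entireLFunction := by
    rw [← hcast, WeierstrassCurve.quadraticTwist_smul W' D, smul_smul, entireLFunction_smul]
  have e2 : ((C₂ • (D • W').quadraticTwist ((-1 : ℚ) ^ (p / 2) * p)).quadraticTwist
        (NumberField.discr K : ℚ)).entireLFunction =
      (W'.quadraticTwist (d₂ : ℚ)).entireLFunction := by
    rw [← hcast, WeierstrassCurve.quadraticTwist_smul _ C₂, quadraticTwist_quadraticTwist,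
      WeierstrassCurve.quadraticTwist_smul W' D, smul_smul,
      show ((d₁ : ℚ)) * (NumberField.discr K : ℚ) = (d₂ : ℚ) by push_cast [hd₂def]; ring,
      entireLFunction_smul]
  simp only [LDerivEK, e1, e2]

/-- **(L1) with `p ∤ d_K` read off the Heegner hypothesis**: on the door `p ∣ N` (the level of the
datum of `E`, `v_p(N) = 2`) and every prime of `N` splits in `K`, so `p ∤ d_K`
(tree `SatisfiesHeegnerHypothesis.not_dvd_discr`). [cite: Gross2004, §2 p. 40] -/
theorem artinLink_of_gross2004_of_heegner
    (hG : Gross2004.rankinLSeries_eq_mul_quadraticTwist) (hmod : hasEntireLFunction_rat)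
    {p : ℕ} [Fact p.Prime] (hp2 : p ≠ 2)
    (W' : WeierstrassCurve ℚ) [W'.IsElliptic] [NeZero (W'.conductorNorm ℤ)]
    (D C₂ : VariableChange ℚ)
    (K : Type) [Field K] [NumberField K] (hK : IsImaginaryQuadratic K)
    {N : ℕ} (hHe : SatisfiesHeegnerHypothesis N K) (hpN : p ∣ N)
    (ιc : K →+* ℂ) (Dt' : ModularParametrizationData W' (W'.conductorNorm ℤ))
    (χ : ringClassGal ιc p →* ℂˣ) (χgal : Field.absoluteGaloisGroup K →ₜ* ℂˣ)
    (emb : ringClassField K ιc p →+* AlgebraicClosure K)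
    (hemb : ∀ k : K, emb (algebraMap K (ringClassField K ιc p) k) =
      algebraMap K (AlgebraicClosure K) k)
    (hinfl : IsInflationAlong ιc p emb χ χgal) (hprim : IsPrimitiveOfConductor ιc p χ)
    (hHC : HeegnerConditionRC W' K p Dt'.f χgal)
    (s : ringClassGal ιc p → ℤˣ) (hχ : ∀ σ, ((χ σ : ℂˣ) : ℂ) = ((s σ : ℤ) : ℂ))
    (θ : ringClassField K ιc p)
    (hθ2 : θ ^ 2 = algebraMap ℚ (ringClassField K ιc p) ((-1 : ℚ) ^ (p / 2) * p)) (hθ : θ ≠ 0)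
    (hθσ : ∀ σ : ringClassGal ιc p, σ.1 θ = ((s σ : ℤ) : ringClassField K ιc p) * θ) :
    rankinSelbergDerivValue Dt'.f χgal 1 =
      LDerivEK (C₂ • (D • W').quadraticTwist ((-1 : ℚ) ^ (p / 2) * p)) K :=
  artinLink_of_gross2004 hG hmod hp2 W' D C₂ K hK
    (Literature.SatisfiesHeegnerHypothesis.not_dvd_discr hK.1 hHe (Fact.out : p.Prime) hpN)
    ιc Dt' χ χgal emb hemb hinfl hprim hHC s hχ θ hθ2 hθ hθσ

end Summit.BirchSwinnertonDyer.BirchSwinnertonDyer.Theorems.SchneiderFree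

end
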